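import Summits.ValiantsHypothesis.ValiantsHypothesis.Theorems.NcUniqueParseTreeRank
import HarnessLib

/-!
# Partial-derivative flattenings of noncommutative polynomials and the distance lemma (FLOS20 §3.2)

FLOS20 = Fijalkow–Lagarde–Ohlmann–Serre, «Lower bounds for arithmetic circuits via the Hankel
matrix», STACS 2020. §3.2 (p. 9–10): for a homogeneous noncommutative polynomial `f` of degree `d`
over the letters `σ` (`n = |σ|`) and a set of POSITIONS `A ⊆ [d]`, the PARTIAL-DERIVATIVE MATRIX
`M_A(f)` has rows the words on the positions off `A`, columns the words on `A`, and entry the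
coefficient in `f` of the merged word (Nisan's matrix is the interval case `A = [0, i)`; the landed
`ivFlat a m b` of `NcUniqueParseTreeRank` (LLS18 = Lagarde–Limaye–Srinivasan 2018, §3) is the
interval case `A = [a, a+m)`). The DISTANCE `dist(A, B) = min(|A Δ B|, |Aᶜ Δ B|)` and
FLOS20 Lemma 9: `rank M_A(f) ≤ n^{dist(A,B)} · rank M_B(f)`.
THIS FILE (INSTRUMENT; linear algebra only): `flat K Y f` = `M_A(f)` for `A = {i | Y i}`
(`mergeWord`, `flat`, `flat_apply`), `hamming` = `|A Δ B|`, `bnot` = complement, `bdist` = `dist`,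
`ivInd d a m` = the interval `[a, a+m)`; the ONE-SHOT Hamming step `rank M_A ≤ n^{|A Δ B|} rank M_B`
(`rank_flat_le_of_hamming`: `M_A = Σ_x D_x · M_B[rows, cols] · D'_x` over the `n^{|A Δ B|}` letter
patterns `x` on the differing positions, each summand a bordered submatrix of `M_B`), the
complement `rank M_{Aᶜ} = rank M_A` (`rank_flat_bnot`, transpose + reindexing), the distance lemma
(`rank_flat_le_of_bdist`), the identification of the interval case with `ivFlat`
(`rank_flat_ivInd`) and subadditivity (`rank_sum_le`, `rank_flat_sum_le`). Consumers: the Hankel /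
parse-tree interval bound (FLOS20 Theorem 13) of `NcHankelIntervalBound` and, through it, the
non-skew-depth dial (LMS16 = Limaye–Malod–Srinivasan 2016, Theorem 1.3 / FLOS20 Theorem 20).
INSTRUMENT · print-KNOWN (FLOS20 §3.2, Lemma 9) · 0 S-currency · closes NO item · A_nc stmt-23446 /
PerNotNcVP / VP ≠ VNP untouched.
[cite: FijalkowLagardeOhlmannSerre2020, §3.2 (p. 9–10), Lemma 9]
[cite: LagardeLimayeSrinivasan2018, §3 Lemma 9]
[cite: LimayeMalodSrinivasan2016, Theorem 1.3]
[cite: HrubesWigdersonYehudayoff2010, §2 (coefficient functionals)]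
-/

noncomputable section

namespace Summit.ValiantsHypothesis.ValiantsHypothesis.Theorems.NcPartialDerivative

set_option linter.dupNamespace false
open Summit.ValiantsHypothesis.ValiantsHypothesis.Theorems.NcSOSDegreeFour
  Summit.ValiantsHypothesis.ValiantsHypothesis.Theorems.NcUniqueParseTreeRank

universe u v w

variable (K : Type u) [Field K] {σ : Type v}

/-- Merge an OUTSIDE word (letters on the positions off `Y`) and an INSIDE word (letters on `Y`)
into one word of length `d`. [cite: FijalkowLagardeOhlmannSerre2020, §3.2] -/
def mergeWord {d : ℕ} (Y : Fin d → Bool) (u : {i : Fin d // Y i = false} → σ)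
    (v : {i : Fin d // Y i = true} → σ) : List σ :=
  List.ofFn fun i : Fin d => if h : Y i = true then v ⟨i, h⟩ else u ⟨i, Bool.eq_false_iff.mpr h⟩

/-- **The partial-derivative matrix `M_A(f)`** (`A = {i | Y i}` ⊆ `[d]`): rows = words on the
positions off `A`, columns = words on `A`, entry = the coefficient in `f` of the merged word; linear
in `f` (`ivFlat a m b` of `NcUniqueParseTreeRank` is the interval case `A = [a, a+m)` up to
reindexing, `rank_flat_ivInd`). [cite: FijalkowLagardeOhlmannSerre2020, §3.2] -/
def flat {d : ℕ} (Y : Fin d → Bool) :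
    FreeAlgebra K σ →ₗ[K]
      Matrix ({i : Fin d // Y i = false} → σ) ({i : Fin d // Y i = true} → σ) K where
  toFun f := fun u v => coeff (mergeWord Y u v) f
  map_add' f g := by funext u v; simp only [map_add]; rfl
  map_smul' a f := by funext u v; simp only [map_smul, smul_eq_mul, RingHom.id_apply]; rfl

/-- [cite: FijalkowLagardeOhlmannSerre2020, §3.2] -/
theorem flat_apply {d : ℕ} (Y : Fin d → Bool) (f : FreeAlgebra K σ)
    (u : {i : Fin d // Y i = false} → σ) (v : {i : Fin d // Y i = true} → σ) :
    flat K Y f u v = coeff (mergeWord Y u v) f := rfl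

/-- The Hamming distance `|A Δ B|` of two position sets. [cite: FijalkowLagardeOhlmannSerre2020, §3.2] -/
def hamming {d : ℕ} (Y Z : Fin d → Bool) : ℕ := (Finset.univ.filter fun i => Y i ≠ Z i).card

/-- The complement `[d] \ A`. [cite: FijalkowLagardeOhlmannSerre2020, §3.2] -/
def bnot {d : ℕ} (Y : Fin d → Bool) : Fin d → Bool := fun i => !Y i

/-- `dist(A, B) = min (|A Δ B|, |Aᶜ Δ B|)`. [cite: FijalkowLagardeOhlmannSerre2020, §3.2] -/
def bdist {d : ℕ} (Y Z : Fin d → Bool) : ℕ := min (hamming Y Z) (hamming (bnot Y) Z)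

/-- The indicator of the interval `[a, a+m)` of positions. [cite: FijalkowLagardeOhlmannSerre2020, §3.2] -/
def ivInd (d a m : ℕ) : Fin d → Bool := fun i => decide (a ≤ i.val ∧ i.val < a + m)

variable [Fintype σ]

/-- Subadditivity of the rank over a finite sum of matrices (ranges: `range (A + B) ≤ range A ⊔
range B`). [folklore] -/
theorem rank_sum_le {ι : Type w} {m n : Type*} [Fintype m] [Fintype n] (s : Finset ι)
    (A : ι → Matrix m n K) :
    (∑ i ∈ s, A i).rank ≤ ∑ i ∈ s, (A i).rank := by
  classical
  refine Finset.induction_on s (by simp [Matrix.rank_zero]) ?_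
  intro i s hi ih
  rw [Finset.sum_insert hi, Finset.sum_insert hi]
  have h2 : (A i + ∑ x ∈ s, A x).rank ≤ (A i).rank + (∑ x ∈ s, A x).rank := by
    unfold Matrix.rank
    rw [Matrix.mulVecLin_add]
    have hle : LinearMap.range ((A i).mulVecLin + (∑ x ∈ s, A x).mulVecLin) ≤
        LinearMap.range (A i).mulVecLin ⊔ LinearMap.range (∑ x ∈ s, A x).mulVecLin := by
      rintro _ ⟨y, rfl⟩
      exact Submodule.add_mem_sup ⟨y, rfl⟩ ⟨y, rfl⟩
    exact (Submodule.finrank_mono hle).trans (Submodule.finrank_add_le_finrank_add_finrank _ _)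
  exact h2.trans (Nat.add_le_add_left ih _)

/-- **DISTANCE LEMMA, Hamming form**: `rank M_A(f) ≤ n^{|A Δ B|} · rank M_B(f)`. One shot: for each
letter pattern `x` on the differing positions, `D_x · M_B[ρ_x, κ_x] · D'_x` selects the rows /
columns of `M_A` whose merged word carries `x` there and reads the entry in `M_B`; `M_A` is the sum
of these `n^{|A Δ B|}` bordered submatrices of `M_B`. [cite: FijalkowLagardeOhlmannSerre2020, Lemma 9] -/
theorem rank_flat_le_of_hamming {d : ℕ} (Y Z : Fin d → Bool) (f : FreeAlgebra K σ) :
    (flat K Y f).rank ≤ Fintype.card σ ^ hamming Y Z * (flat K Z f).rank := by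
  classical
  -- readers: the `Z`-row / `Z`-column word determined by a `Y`-row word `u`, a `Y`-column word `v`
  -- and letters `x` on the differing positions
  let ru : ({i : Fin d // Y i ≠ Z i} → σ) → ({i : Fin d // Y i = false} → σ) →
      ({i : Fin d // Z i = false} → σ) := fun x u j =>
    if h : Y j.1 = true then x ⟨j.1, by simp [h, j.2]⟩ else u ⟨j.1, Bool.eq_false_iff.mpr h⟩
  let rv : ({i : Fin d // Y i ≠ Z i} → σ) → ({i : Fin d // Y i = true} → σ) →
      ({i : Fin d // Z i = true} → σ) := fun x v j =>
    if h : Y j.1 = true then v ⟨j.1, h⟩ else x ⟨j.1, by rw [j.2]; exact h⟩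
  -- borders: the rows / columns whose own letters agree with `x` on the differing positions
  let ca : ({i : Fin d // Y i ≠ Z i} → σ) → ({i : Fin d // Y i = false} → σ) → K := fun x u =>
    if ∀ j : {i : Fin d // Y i ≠ Z i}, ∀ h : Y j.1 = false, x j = u ⟨j.1, h⟩ then 1 else 0
  let cb : ({i : Fin d // Y i ≠ Z i} → σ) → ({i : Fin d // Y i = true} → σ) → K := fun x v =>
    if ∀ j : {i : Fin d // Y i ≠ Z i}, ∀ h : Y j.1 = true, x j = v ⟨j.1, h⟩ then 1 else 0
  have key : flat K Y f = ∑ x : {i : Fin d // Y i ≠ Z i} → σ,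
      Matrix.diagonal (ca x) * (flat K Z f).submatrix (ru x) (rv x) * Matrix.diagonal (cb x) := by
    ext u v
    -- the letters of the merged word of `(u, v)` on the differing positions
    let x₀ : {i : Fin d // Y i ≠ Z i} → σ := fun j =>
      if h : Y j.1 = true then v ⟨j.1, h⟩ else u ⟨j.1, Bool.eq_false_iff.mpr h⟩
    have hw : mergeWord Y u v = mergeWord Z (ru x₀ u) (rv x₀ v) := by
      unfold mergeWord
      refine congrArg List.ofFn (funext fun i => ?_)
      by_cases hY : Y i = true <;> by_cases hZ : Z i = true <;> simp [ru, rv, x₀, hY, hZ]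
    have hval : ∀ x : {i : Fin d // Y i ≠ Z i} → σ,
        (Matrix.diagonal (ca x) * (flat K Z f).submatrix (ru x) (rv x) * Matrix.diagonal (cb x))
          u v = ca x u * flat K Z f (ru x u) (rv x v) * cb x v := fun x => by
      rw [Matrix.mul_diagonal, Matrix.diagonal_mul, Matrix.submatrix_apply]
    rw [Matrix.sum_apply, Fintype.sum_eq_single x₀]
    · -- the diagonal term reads the entry of `M_B` at the re-split merged word
      have ha : ∀ j : {i : Fin d // Y i ≠ Z i}, ∀ h : Y j.1 = false, x₀ j = u ⟨j.1, h⟩ :=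
        fun j h => by simp [x₀, h]
      have hb : ∀ j : {i : Fin d // Y i ≠ Z i}, ∀ h : Y j.1 = true, x₀ j = v ⟨j.1, h⟩ :=
        fun j h => by simp [x₀, h]
      rw [hval]
      simp only [ca, cb]
      rw [if_pos ha, if_pos hb, one_mul, mul_one, flat_apply, flat_apply, hw]
    · -- every other pattern is killed by one of the two borders
      intro x hx
      rw [hval]
      have hne : ¬ ((∀ j : {i : Fin d // Y i ≠ Z i}, ∀ h : Y j.1 = false, x j = u ⟨j.1, h⟩) ∧
          ∀ j : {i : Fin d // Y i ≠ Z i}, ∀ h : Y j.1 = true, x j = v ⟨j.1, h⟩) := by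
        rintro ⟨h1, h2⟩
        apply hx
        funext j
        by_cases h : Y j.1 = true
        · rw [h2 j h]; simp [x₀, h]
        · rw [h1 j (Bool.eq_false_iff.mpr h)]; simp [x₀, h]
      rcases not_and_or.mp hne with h | h
      · simp only [ca]
        rw [if_neg h, zero_mul, zero_mul]
      · simp only [cb]
        rw [if_neg h, mul_zero]
  calc (flat K Y f).rank
      = (∑ x : {i : Fin d // Y i ≠ Z i} → σ, Matrix.diagonal (ca x) *
          (flat K Z f).submatrix (ru x) (rv x) * Matrix.diagonal (cb x)).rank := by rw [key]
    _ ≤ ∑ x : {i : Fin d // Y i ≠ Z i} → σ, (Matrix.diagonal (ca x) *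
          (flat K Z f).submatrix (ru x) (rv x) * Matrix.diagonal (cb x)).rank := rank_sum_le K _ _
    _ ≤ ∑ _x : {i : Fin d // Y i ≠ Z i} → σ, (flat K Z f).rank :=
        Finset.sum_le_sum fun x _ => (Matrix.rank_mul_le_left _ _).trans
          ((Matrix.rank_mul_le_right _ _).trans (Matrix.rank_submatrix_le _ _ _))
    _ = Fintype.card σ ^ hamming Y Z * (flat K Z f).rank := by
        rw [Finset.sum_const, Finset.card_univ, smul_eq_mul, Fintype.card_fun, Fintype.card_subtype]
        rfl

/-- ONE-POSITION STEP: moving one position between rows and columns costs a factor `n = |σ|`.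
[cite: FijalkowLagardeOhlmannSerre2020, Lemma 9] -/
theorem rank_flat_le_of_hamming_eq_one {d : ℕ} {Y Z : Fin d → Bool} (h : hamming Y Z = 1)
    (f : FreeAlgebra K σ) : (flat K Y f).rank ≤ Fintype.card σ * (flat K Z f).rank := by
  simpa [h] using rank_flat_le_of_hamming K Y Z f

/-- `M_{Aᶜ}(f)` is the transpose of `M_A(f)` up to reindexing: equal ranks.
[cite: FijalkowLagardeOhlmannSerre2020, §3.2] -/
theorem rank_flat_bnot {d : ℕ} (Y : Fin d → Bool) (f : FreeAlgebra K σ) :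
    (flat K (bnot Y) f).rank = (flat K Y f).rank := by
  classical
  let e₁ : {i : Fin d // bnot Y i = false} ≃ {i : Fin d // Y i = true} :=
    Equiv.subtypeEquivRight fun i => by simp [bnot]
  let e₂ : {i : Fin d // bnot Y i = true} ≃ {i : Fin d // Y i = false} :=
    Equiv.subtypeEquivRight fun i => by simp [bnot]
  have hM : flat K (bnot Y) f = ((flat K Y f).transpose).submatrix
      (Equiv.arrowCongr e₁ (Equiv.refl σ)) (Equiv.arrowCongr e₂ (Equiv.refl σ)) := by
    ext u v
    rw [Matrix.submatrix_apply, Matrix.transpose_apply, flat_apply, flat_apply]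
    refine congrArg (fun w => coeff w f) ?_
    unfold mergeWord
    refine congrArg List.ofFn (funext fun i => ?_)
    by_cases hY : Y i = true <;> simp [bnot, hY] <;> rfl
  rw [hM, Matrix.rank_submatrix, Matrix.rank_transpose]

/-- **DISTANCE LEMMA** (FLOS20 Lemma 9): `rank M_A(f) ≤ n^{dist(A,B)} · rank M_B(f)`.
[cite: FijalkowLagardeOhlmannSerre2020, Lemma 9] -/
theorem rank_flat_le_of_bdist {d : ℕ} (Y Z : Fin d → Bool) (f : FreeAlgebra K σ) :
    (flat K Y f).rank ≤ Fintype.card σ ^ bdist Y Z * (flat K Z f).rank := by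
  unfold bdist
  rcases min_choice (hamming Y Z) (hamming (bnot Y) Z) with h | h <;> rw [h]
  · exact rank_flat_le_of_hamming K Y Z f
  · rw [← rank_flat_bnot K Y f]
    exact rank_flat_le_of_hamming K (bnot Y) Z f

/-- The interval flattening IS `ivFlat` (reindexing rows `(prefix, suffix)` and columns).
[cite: LagardeLimayeSrinivasan2018, §3 Lemma 9] -/
theorem rank_flat_ivInd (a m b : ℕ) (f : FreeAlgebra K σ) :
    (flat K (ivInd (a + m + b) a m) f).rank = (ivFlat K a m b f).rank := by
  classical
  have P1 : ∀ j : Fin a, ivInd (a + m + b) a m (Fin.castAdd b (Fin.castAdd m j)) = false :=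
    fun j => by simp only [ivInd, Fin.val_castAdd, decide_eq_false_iff_not]; omega
  have P2 : ∀ j : Fin b, ivInd (a + m + b) a m (Fin.natAdd (a + m) j) = false :=
    fun j => by simp only [ivInd, Fin.val_natAdd, decide_eq_false_iff_not]; omega
  have P3 : ∀ j : Fin m, ivInd (a + m + b) a m (Fin.castAdd b (Fin.natAdd a j)) = true :=
    fun j => by simp only [ivInd, Fin.val_castAdd, Fin.val_natAdd, decide_eq_true_eq]; omega
  -- the positions off `[a, a+m)` are the prefix `[0, a)` and the suffix `[a+m, a+m+b)`
  have Q : ∀ i : {i : Fin (a + m + b) // ivInd (a + m + b) a m i = false}, ¬ (i.1 : ℕ) < a →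
      (i.1 : ℕ) - (a + m) < b := fun i h => by
    have h2 := i.2
    simp only [ivInd, decide_eq_false_iff_not] at h2
    omega
  have Q' : ∀ i : {i : Fin (a + m + b) // ivInd (a + m + b) a m i = true}, a ≤ (i.1 : ℕ) ∧
      (i.1 : ℕ) - a < m := fun i => by
    have h2 := i.2
    simp only [ivInd, decide_eq_true_eq] at h2
    omega
  let eRow : ({i : Fin (a + m + b) // ivInd (a + m + b) a m i = false} → σ) ≃
      ((Fin a → σ) × (Fin b → σ)) :=
    { toFun := fun u => (fun j => u ⟨Fin.castAdd b (Fin.castAdd m j), P1 j⟩,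
        fun j => u ⟨Fin.natAdd (a + m) j, P2 j⟩)
      invFun := fun y i =>
        if h : (i.1 : ℕ) < a then y.1 ⟨(i.1 : ℕ), h⟩ else y.2 ⟨(i.1 : ℕ) - (a + m), Q i h⟩
      left_inv := fun u => by
        funext i
        show dite _ _ _ = _
        split
        · exact congrArg u (Subtype.ext (Fin.ext rfl))
        · rename_i h
          have h2 := i.2
          simp only [ivInd, decide_eq_false_iff_not] at h2
          exact congrArg u (Subtype.ext (Fin.ext (by
            simp only [Fin.val_natAdd]; omega)))
      right_inv := fun y => by
        refine Prod.ext (funext fun j => ?_) (funext fun j => ?_)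
        · show dite _ _ _ = _
          split
          · exact congrArg y.1 (Fin.ext rfl)
          · rename_i h
            exact absurd (Fin.isLt j) h
        · show dite _ _ _ = _
          split
          · rename_i h
            exact absurd h (by simp only [Fin.val_natAdd]; omega)
          · exact congrArg y.2 (Fin.ext (by simp only [Fin.val_natAdd]; omega)) }
  let eCol : ({i : Fin (a + m + b) // ivInd (a + m + b) a m i = true} → σ) ≃ (Fin m → σ) :=
    { toFun := fun v j => v ⟨Fin.castAdd b (Fin.natAdd a j), P3 j⟩
      invFun := fun A i => A ⟨(i.1 : ℕ) - a, (Q' i).2⟩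
      left_inv := fun v => by
        funext i
        have h1 := (Q' i).1
        exact congrArg v (Subtype.ext (Fin.ext (by
          simp only [Fin.val_castAdd, Fin.val_natAdd]; omega)))
      right_inv := fun A => by
        funext j
        exact congrArg A (Fin.ext (by simp only [Fin.val_castAdd, Fin.val_natAdd]; omega)) }
  have hM : flat K (ivInd (a + m + b) a m) f = (ivFlat K a m b f).submatrix eRow eCol := by
    ext u v
    have hG : (fun i : Fin (a + m + b) => if h : ivInd (a + m + b) a m i = true then v ⟨i, h⟩
        else u ⟨i, Bool.eq_false_iff.mpr h⟩) =
        Fin.append (Fin.append (eRow u).1 (eCol v)) (eRow u).2 := by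
      funext i
      induction i using Fin.addCases with
      | left i =>
        rw [Fin.append_left]
        induction i using Fin.addCases with
        | left j =>
          rw [Fin.append_left]
          exact dif_neg (Bool.eq_false_iff.mp (P1 j))
        | right j =>
          rw [Fin.append_right]
          exact dif_pos (P3 j)
      | right j =>
        rw [Fin.append_right]
        exact dif_neg (Bool.eq_false_iff.mp (P2 j))
    rw [flat_apply, Matrix.submatrix_apply, ivFlat_apply, ← List.ofFn_fin_append,
      ← List.ofFn_fin_append]
    exact congrArg (fun g => coeff (List.ofFn g) f) hG
  rw [hM, Matrix.rank_submatrix]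

/-- Subadditivity over a finite sum (linearity of `flat` + `Matrix.rank_add_le`). [folklore] -/
theorem rank_flat_sum_le {ι : Type w} (s : Finset ι) {d : ℕ} (Y : Fin d → Bool)
    (f : ι → FreeAlgebra K σ) :
    (flat K Y (∑ i ∈ s, f i)).rank ≤ ∑ i ∈ s, (flat K Y (f i)).rank := by
  rw [map_sum]
  exact rank_sum_le K s _

end Summit.ValiantsHypothesis.ValiantsHypothesis.Theorems.NcPartialDerivative
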